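import Literature.NumberTheory.EllipticCurves.TateCurve.SplitOfRationalTorsion
import Literature.NumberTheory.EllipticCurves.TateCurve.NumberFieldUniformizationTwisted
import HarnessLib

/-!
# Full `n`-torsion (`n ≥ 3`) rational over `K_v` forces SPLIT multiplicative reduction — UNCONDITIONAL
# (Silverman ATAEC V.5.3 + Cor. V.5.4; consumer: [IUTchI] Ex. 3.2 (iv))

Topic `Literature/NumberTheory/EllipticCurves/TateCurve`, namespace
`Literature.NumberTheory.EllipticCurves.TateCurve` (abc-iut cell, WAVE-5 seat abc-iut-w5-d219 gen 2; support
for the DAG node IUTchI:Ex3.2(iv)). PROOF-ONLY: theorems, no definitions, no named facts.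

The file `SplitOfRationalTorsion.lean` (this lineage, p417368) proved, CONDITIONALLY on the tree's named fact
`Literature.NumberTheory.EllipticCurves.Silverman1994_thmV53_corV54_tateUniformisation` (Silverman, *Advanced
Topics in the Arithmetic of Elliptic Curves*, Lemma V.5.2 (c), Thm. V.5.3, Cor. V.5.4), that an elliptic curve
`W` over a number field `K` with multiplicative reduction at a finite place `v` and `n²` distinct `K_v`-rational
points killed by some `n ≥ 3` has `γ(W) = -c₄/c₆` a square in `K_v` and SPLIT multiplicative reduction at `v`.
The named fact has since been DISCHARGED in the tree
(`Literature.NumberTheory.EllipticCurves.TateCurve.Silverman1994_thmV53_corV54_tateUniformisation_holds`,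
`NumberFieldUniformizationTwisted.lean`, seat abc-iut-w5-d205), so both conclusions are now UNCONDITIONAL:

* `isSquare_gamma_of_card_torsion`,
* `hasSplitMultiplicativeReductionAt_of_card_torsion` — any parity of `n` (the odd case is also covered,
  with the sharper hypothesis `n < #S`, by `hasSplitMultiplicativeReductionAt_of_odd_torsion` of
  `SplitOfOddTorsion.lean`, abc-iut-L5-t12; the even case, e.g. sixteen rational `4`-torsion points, is new),
* `hasSplitMultiplicativeReductionAt_of_card_torsion_baseChange` — the same for a finite extension `L/K` read at
  a place `w` of `L`: the shape in which [IUTchI] Def. 3.1 (b)(c) feeds Ex. 3.2 (iv) (`E_F[l] ⊆ E_F(K)`,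
  `K = F(E_F[l])`, `l ≥ 5`).

Classical (Tate/Silverman); nothing here bears on [IUTchIII] Cor. 3.12.

## References
* [SilvermanATAEC1994] J. H. Silverman, *Advanced Topics in the Arithmetic of Elliptic Curves*, GTM 151,
  Springer 1994, Lemma V.5.2, Thm. V.5.3, Cor. V.5.4 (held copy PDF pp. 406–410).
* [Mochizuki2012] S. Mochizuki, *Inter-universal Teichmüller theory I*, Def. 3.1 (b)(c) pp. 61–62, Example 3.2
  (iv) p. 71 (consumer only).
-/

noncomputable section

open scoped Classical

namespace Literature.NumberTheory.EllipticCurves.TateCurve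

open WeierstrassCurve NumberField IsDedekindDomain

variable {K : Type} [Field K] [NumberField K]

/-- **`n²` rational `n`-torsion points over `K_v`, `n ≥ 3`, force `γ(W) = −c₄/c₆` to be a square in `K_v`**
at a place `v` of multiplicative reduction — UNCONDITIONAL (Silverman ATAEC V.5.3 with Lemma V.5.2 (c) /
Cor. V.5.4, the named fact being the tree's theorem `Silverman1994_thmV53_corV54_tateUniformisation_holds`).
[cite: SilvermanATAEC1994, Thm. V.5.3 and Cor. V.5.4 (PDF pp. 407–410)] -/
theorem isSquare_gamma_of_card_torsion
    (W : WeierstrassCurve K) [W.IsElliptic] (v : HeightOneSpectrum (𝓞 K))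
    (hmult : W.HasMultiplicativeReductionAt v) {n : ℕ} (hn : 3 ≤ n)
    (S : Finset (W.baseChange (v.adicCompletion K)).toAffine.Point) (hS : ∀ P ∈ S, n • P = 0)
    (hcard : n ^ 2 ≤ S.card) :
    IsSquare (algebraMap K (v.adicCompletion K) (-(W.c₄ / W.c₆))) :=
  isSquare_gamma_of_card_torsion_of_corV54 Silverman1994_thmV53_corV54_tateUniformisation_holds
    W v hmult hn S hS hcard

/-- **`n²` rational `n`-torsion points over `K_v`, `n ≥ 3`, at a place of multiplicative reduction force
SPLIT multiplicative reduction** (of the chosen local minimal model: `W.HasSplitMultiplicativeReductionAt v`)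
— UNCONDITIONAL: Silverman ATAEC V.5.3 (b) (`γ` square ⇒ split, the tree's `splitMultiplicative_tfae_holds`)
on top of `isSquare_gamma_of_card_torsion`. Consumer: the residual `hsplit` of [IUTchI] Ex. 3.2 (iv)
(`InitialThetaData.exists_pow_two_mul_l_eq_tateParameter`, with `n := l`).
[cite: SilvermanATAEC1994, Thm. V.5.3 (b) and Cor. V.5.4 (PDF pp. 407–410)] -/
theorem hasSplitMultiplicativeReductionAt_of_card_torsion
    (W : WeierstrassCurve K) [W.IsElliptic] (v : HeightOneSpectrum (𝓞 K))
    (hmult : W.HasMultiplicativeReductionAt v) {n : ℕ} (hn : 3 ≤ n)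
    (S : Finset (W.baseChange (v.adicCompletion K)).toAffine.Point) (hS : ∀ P ∈ S, n • P = 0)
    (hcard : n ^ 2 ≤ S.card) : W.HasSplitMultiplicativeReductionAt v :=
  hasSplitMultiplicativeReductionAt_of_card_torsion_of_corV54
    Silverman1994_thmV53_corV54_tateUniformisation_holds W v hmult hn S hS hcard

omit [NumberField K] in
/-- **The base-changed form.** For a finite extension of number fields `L/K` (any `[Algebra K L]`), a place
`w` of `L` at which `W ⊗_K L` has multiplicative reduction, and `n²` points of `W ⊗_K L` rational over `L_w`
killed by `n ≥ 3` — e.g. the images of `n²` `L`-rational `n`-torsion points — the curve `W ⊗_K L` has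
SPLIT multiplicative reduction at `w`. This is the shape in which [IUTchI] Def. 3.1 (b) (multiplicative
reduction over `𝕍^bad_mod`) and (c) (`E_F[l] ⊆ E_F(K)`, `l ≥ 5`) give «`E_K` is a (split) Tate curve at
`v̲ ∈ 𝕍^bad`» used in Ex. 3.2 (iv). UNCONDITIONAL.
[cite: SilvermanATAEC1994, Thm. V.5.3 (b) and Cor. V.5.4 (PDF pp. 407–410)]
[cite: Mochizuki2012, Def. 3.1 (b)(c) pp. 61–62; Example 3.2 (iv) p. 71] -/
theorem hasSplitMultiplicativeReductionAt_of_card_torsion_baseChange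
    (W : WeierstrassCurve K) [W.IsElliptic] (L : Type) [Field L] [NumberField L] [Algebra K L]
    (w : HeightOneSpectrum (𝓞 L))
    (hmult : (W.baseChange L).HasMultiplicativeReductionAt w) {n : ℕ} (hn : 3 ≤ n)
    (S : Finset (W.baseChange L).toAffine.Point) (hS : ∀ P ∈ S, n • P = 0)
    (hcard : n ^ 2 ≤ S.card) : (W.baseChange L).HasSplitMultiplicativeReductionAt w := by
  haveI : (W.baseChange L).IsElliptic := inferInstanceAs (W.map (algebraMap K L)).IsElliptic
  -- push the `L`-rational torsion points to `L_w`
  let f : (W.baseChange L).toAffine.Point →+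
      ((W.baseChange L).baseChange (w.adicCompletion L)).toAffine.Point :=
    WeierstrassCurve.Affine.Point.map (W' := W.baseChange L) (Algebra.ofId L (w.adicCompletion L))
  have hf : Function.Injective f :=
    WeierstrassCurve.Affine.Point.map_injective (W' := W.baseChange L)
      (f := Algebra.ofId L (w.adicCompletion L))
  refine hasSplitMultiplicativeReductionAt_of_card_torsion (W.baseChange L) w hmult hn (S.map ⟨f, hf⟩)
    ?_ ?_
  · intro P hP
    obtain ⟨Q, hQ, rfl⟩ := Finset.mem_map.mp hP
    show n • f Q = 0
    rw [← map_nsmul, hS Q hQ, map_zero]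
  · rwa [Finset.card_map]

end Literature.NumberTheory.EllipticCurves.TateCurve

end
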